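import Literature.MathematicalPhysics.QuantumFieldTheory.Balaban1983to89.B12Eq419Kernel
import Literature.Analysis.Complex.HolomorphicBanach

/-!
# `Balaban1983to89.B12Eq422KernelCauchy` — T. Bałaban, *Renormalization group approach to lattice gauge field theories. I*, Commun. Math. Phys.
# **109** (1987) 249–301 [Balaban1987RG1] §4, (4.2)–(4.5) p. 281–282 and (4.21)–(4.22) p. 285–286: THE DECAY-FREE CAUCHY CORE OF THE KERNEL
# BOUNDS — the kernels `𝐄⁽ⁿ⁾(x₁,…,x_n)` of the derivatives of a BOUNDED ANALYTIC COMPOSITE `F ∘ Φ` (old term ∘ chart) on a sup-norm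
# configuration ball are bounded by `M·(n∕ρ)ⁿ`, pointwise and summed against fields in the `ℓ¹`-shape

statement-level skeleton of published theorems with citation tags; proofs where landed; nothing here is a claim about the Yang–Mills mass gap

PDF held: `paper:balaban1987-cmp109-rg-i-small-field` (journal page = PDF page + 248); pp. 281–282 [PDF 33–34] and 285–286 [37–38] read on the
text layer this session (2026-08-22).  THE PRINT.  p. 281: *«Using the gauge transformation in (3.37), and the gauge invariance of the function
E^{(j)}(X, U), we have E^{(j)}(X, U_j(□₀, exp iB)) = E^{(j)}(X, exp iξH_j(□₀,B)). (4.2) Differentiating the composite function on the right-hand side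
above n times with respect to B, we obtain the identities (4.3) … this function is analytic on the corresponding spaces of variables U, J, A,
and this fact is quite general, valid for an arbitrary domain X … Thus it is defined and analytic on the space of configurations A satisfying
(4.4)»*; p. 282: *«The norm in (4.4) of the expression ⟨(δ^{n(p)}∕δB^{n(p)})H_j(□₀,0), ⊗_{i∈N(p)} B_i⟩ can be estimated by B₃∏_{i∈N(p)}|B_i| …»*,
(4.5); p. 286: *«we apply the identities (4.3) with localizations at the points x, x₃ fixed … More generally, let us notice that by a similar
argument we can bound the derivative 𝐄⁽ⁿ⁾(X, x₁,…,x_n) by a constant times the exponential exp(−O(1)κd_j(X ∨ {x₁,…,x_n}))»*, (4.22).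

WHY THIS FILE (cell context; pub-balaban NE9, MODEL item O-NE9-1 (ii) «the kernel species `ker`», owner plan `KER-SPECIES-PLAN.md` g82, K2).
The END `Support/NE9Lemma1KernelSpecies` consumes a kernel `ker … p q F` subject to (K) `kerBound`: for every `F : E → ℂ` holomorphic on
`ball 0 (R X)` with `‖F‖ ≤ M` there, `‖ker … p q F‖ ≤ c_K·M·gain·ρd(p,q)^m·exp(−δ₀(…))`, and `KerZero` (`ker … 0 = 0`).  Print's `ker` is a
kernel of the derivatives of the COMPOSITE (4.2) `B ↦ F(chart(B))` ((4.19): `𝐄⁽ⁿ⁾ = kernelE n (F ∘ Φ̂) b₀`, tree `B12Eq419Kernel`).  Its bound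
(4.22) has two factors of different class: a DECAY factor (the «shortest tree graph» of p. 282 ∕ [Balaban1985Variational] (189)–(190) — the
lattice-uniformity T-row of the whole chain) and an ANALYTICITY factor — the Cauchy estimate for the derivatives of the bounded analytic
composite on the ball (4.4).  This file is the second factor, kernel-certified over abstract letters: the chart `Φ` holomorphic on a ball
and mapping it into the old term's ball of analyticity, `F` holomorphic and bounded by `M` there.

WHAT IS PROVED (sorry-free; [folklore] complex analysis in Banach spaces — tree `Literature.Analysis.Complex.HolomorphicBanach`
(Chae 1985, Cauchy inequalities 13.6) composed with `B12Eq419Kernel` §4; 0 def; no inequality of the paper asserted as printed).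
* §1 **`norm_iteratedFDeriv_le_of_ball`** — `f` holomorphic on `ball x R`, `‖f‖ ≤ M` there, `0 < ρ < R` ⇒ `‖Dⁿf(x)‖ ≤ M·(n∕ρ)ⁿ` (Cauchy
  inequalities with `n` equal steps `δ = ρ∕n`); **`norm_iteratedFDeriv_comp_le_of_ball`** — the same for the COMPOSITE `F ∘ Φ` from
  `Φ` holomorphic on `ball x R_b` with `Φ(ball x R_b) ⊆ ball 0 R_X` and `F` holomorphic on `ball 0 R_X`, `‖F‖ ≤ M` there: `‖Dⁿ(F ∘ Φ)(x)‖ ≤ M·(n∕ρ)ⁿ`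
  for `ρ < R_b` — NO constant of `Φ` enters but its radius (print: B₃'s analyticity part).
* §2 (configurations `ι → 𝔸`, sup norm; the kernels of `B12Eq419Kernel`): **`norm_kernelE_comp_apply_le`** — `‖𝐄⁽ⁿ⁾(xs)[b₁,…,b_n]‖ ≤
  M·(n∕ρ)ⁿ·∏‖b_k‖` for `𝐄 = F ∘ Φ`, EVERY index tuple `xs` («localizations at the points fixed», p. 286 — decay-free); **`norm_kernelE_comp_le`**
  (operator norm); **`kernelE_comp_zero`** — `KerZero`: the kernels of `0 ∘ Φ` vanish; **`sum_norm_kernelE_comp_apply_le`** — the (4.21)∕(4.22)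
  summed shape WITHOUT decay: `Σ_{xs} ‖𝐄⁽ⁿ⁾(xs)[v₁(xs₁),…,v_n(xs_n)]‖ ≤ M·(n∕ρ)ⁿ·∏_k Σ_i ‖v_k(i)‖` (`ℓ¹` norms of the fields; print replaces
  the `ℓ¹` count by the decay-weighted sums (4.22) `c₁(δ₁)`, which this file does not have).
MODEL ∕ HONEST SCOPE.  `E`, `G`, `F`-spaces abstract complex Banach (`F` complete); `ι` finite; the radius `ρ < R_b` free.  The constant `(n∕ρ)ⁿ`
is the equal-step Cauchy constant (not optimal: polarization would give `nⁿ∕n!·ρ⁻ⁿ·n!` = the same order).  NOT the decay factor of (4.5)∕(4.22),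
NOT the field sizes (4.17)–(4.18) ([Balaban1985Averaging] Prop. 5), NOT the Ward–Takahashi identities (4.7)–(4.15), NOT (4.22) as printed.
NOT summit progress (cell pub-balaban: NE9 NOT PRINTED ∕ NOT PROVED; row WALLED ON A MODEL (O-NE9-1); spine PROVED 0∕9; rung (B)+1 finite
T⁴ — NOT infinite volume, NOT mass gap, NOT Clay).  Filed by the pub-balaban NE9 BINDER-row owner lineage `b2b-balaban-t4-ne9-p1` (gen 82);
NEW file importing `B12Eq419Kernel` + `Literature.Analysis.Complex.HolomorphicBanach`; nothing modified.  Net new unproved facts: 0.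
-/

noncomputable section

open Metric Set Finset
open scoped BigOperators

namespace Literature.MathematicalPhysics.QuantumFieldTheory.Balaban1983to89.B12Eq422KernelCauchy

open Literature.MathematicalPhysics.QuantumFieldTheory.Balaban1983to89.B12Eq419Kernel (kernelE kernelE_apply norm_kernelE_apply_le
  norm_kernelOf_le)
open Literature.Analysis.Complex.HolomorphicBanach (norm_iteratedFDeriv_le_of_closedBall)

/-! ## §1 Cauchy inequalities on a ball, and for a bounded analytic composite -/

section Ball

variable {E : Type*} [NormedAddCommGroup E] [NormedSpace ℂ E] {G : Type*} [NormedAddCommGroup G] [NormedSpace ℂ G]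
  {F : Type*} [NormedAddCommGroup F] [NormedSpace ℂ F] [CompleteSpace F]

/-- **Cauchy inequalities with `n` equal steps**: `f` holomorphic on `ball x R` and bounded by `M` there, `0 < ρ < R` ⇒
`‖Dⁿ f(x)‖ ≤ M·(n∕ρ)ⁿ` (the analyticity half of print's constant `B₃`, (4.4)–(4.5)).
[cite: Balaban1987RG1, (4.4)-(4.5) p.281-282; Chae1985, 13.6] -/
theorem norm_iteratedFDeriv_le_of_ball {f : E → F} {x : E} {R ρ M : ℝ} (hf : DifferentiableOn ℂ f (ball x R)) (hρ : 0 < ρ)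
    (hρR : ρ < R) (hM : ∀ z ∈ ball x R, ‖f z‖ ≤ M) (n : ℕ) :
    ‖iteratedFDeriv ℂ n f x‖ ≤ M * ((n : ℝ) / ρ) ^ n := by
  rcases Nat.eq_zero_or_pos n with rfl | hn
  · rw [norm_iteratedFDeriv_zero, pow_zero, mul_one]
    exact hM x (mem_ball_self (hρ.trans hρR))
  · have hδ : 0 < ρ / n := div_pos hρ (by exact_mod_cast hn)
    have hsub : closedBall x ρ ⊆ ball x R := closedBall_subset_ball hρR
    have hj : (n : ℝ) * (ρ / n) ≤ ρ := by
      rw [mul_div_cancel₀ _ (by exact_mod_cast hn.ne')]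
    have hx : x ∈ closedBall x (ρ - n * (ρ / n)) := by
      rw [mul_div_cancel₀ _ (by exact_mod_cast hn.ne'), sub_self]
      exact mem_closedBall_self le_rfl
    have h := norm_iteratedFDeriv_le_of_closedBall hf isOpen_ball hsub (fun z hz => hM z (hsub hz)) hδ n hj hx
    calc ‖iteratedFDeriv ℂ n f x‖ ≤ M / (ρ / n) ^ n := h
      _ = M * ((n : ℝ) / ρ) ^ n := by rw [div_eq_mul_inv, ← inv_pow, inv_div]

/-- **The bounded analytic COMPOSITE** (print (4.2)–(4.5): the old term `F` composed with the chart `Φ`): `Φ` holomorphic on `ball x R_b`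
with `Φ(ball x R_b) ⊆ ball 0 R_X`, `F` holomorphic on `ball 0 R_X` and bounded by `M` there, `0 < ρ < R_b` ⇒ `‖Dⁿ(F ∘ Φ)(x)‖ ≤ M·(n∕ρ)ⁿ`.
[cite: Balaban1987RG1, (4.2)-(4.5) p.281-282] -/
theorem norm_iteratedFDeriv_comp_le_of_ball {Φ : E → G} {F' : G → F} {x : E} {Rb RX ρ M : ℝ} (hΦ : DifferentiableOn ℂ Φ (ball x Rb))
    (hmaps : MapsTo Φ (ball x Rb) (ball 0 RX)) (hF : DifferentiableOn ℂ F' (ball 0 RX)) (hM : ∀ y ∈ ball (0 : G) RX, ‖F' y‖ ≤ M)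
    (hρ : 0 < ρ) (hρR : ρ < Rb) (n : ℕ) :
    ‖iteratedFDeriv ℂ n (F' ∘ Φ) x‖ ≤ M * ((n : ℝ) / ρ) ^ n :=
  norm_iteratedFDeriv_le_of_ball (hF.comp hΦ hmaps) hρ hρR (fun _ hz => hM _ (hmaps hz)) n

end Ball

/-! ## §2 The kernels of the composite on the configuration space `ι → 𝔸` -/

section Kernel

variable {ι : Type*} [Fintype ι] [DecidableEq ι] {𝔸 : Type*} [NormedAddCommGroup 𝔸] [NormedSpace ℂ 𝔸]
  {G : Type*} [NormedAddCommGroup G] [NormedSpace ℂ G] {F : Type*} [NormedAddCommGroup F] [NormedSpace ℂ F] [CompleteSpace F]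

/-- **The kernel values of the composite are bounded, decay-free, at EVERY index tuple** («localizations at the points x, x₃ fixed»,
p. 286): `‖𝐄⁽ⁿ⁾(xs)[b₁,…,b_n]‖ ≤ M·(n∕ρ)ⁿ·∏‖b_k‖` for `𝐄 = F ∘ Φ` as in §1.
[cite: Balaban1987RG1, (4.19) p.285, (4.22) p.286, (4.5) p.282] -/
theorem norm_kernelE_comp_apply_le {Φ : (ι → 𝔸) → G} {F' : G → F} {x : ι → 𝔸} {Rb RX ρ M : ℝ}
    (hΦ : DifferentiableOn ℂ Φ (ball x Rb)) (hmaps : MapsTo Φ (ball x Rb) (ball 0 RX)) (hF : DifferentiableOn ℂ F' (ball 0 RX))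
    (hM : ∀ y ∈ ball (0 : G) RX, ‖F' y‖ ≤ M) (hρ : 0 < ρ) (hρR : ρ < Rb) (n : ℕ) (xs : Fin n → ι) (b : Fin n → 𝔸) :
    ‖kernelE (𝕜 := ℂ) n (F' ∘ Φ) x xs b‖ ≤ M * ((n : ℝ) / ρ) ^ n * ∏ k, ‖b k‖ := by
  refine norm_kernelE_apply_le n _ x (fun v => ?_) xs b
  exact (ContinuousMultilinearMap.le_opNorm _ v).trans (mul_le_mul_of_nonneg_right
    (norm_iteratedFDeriv_comp_le_of_ball hΦ hmaps hF hM hρ hρR n) (Finset.prod_nonneg fun k _ => norm_nonneg _))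

/-- Operator-norm form: `‖𝐄⁽ⁿ⁾(xs)‖ ≤ M·(n∕ρ)ⁿ`. [cite: Balaban1987RG1, (4.19) p.285, (4.22) p.286] -/
theorem norm_kernelE_comp_le {Φ : (ι → 𝔸) → G} {F' : G → F} {x : ι → 𝔸} {Rb RX ρ M : ℝ}
    (hΦ : DifferentiableOn ℂ Φ (ball x Rb)) (hmaps : MapsTo Φ (ball x Rb) (ball 0 RX)) (hF : DifferentiableOn ℂ F' (ball 0 RX))
    (hM : ∀ y ∈ ball (0 : G) RX, ‖F' y‖ ≤ M) (hρ : 0 < ρ) (hρR : ρ < Rb) (n : ℕ) (xs : Fin n → ι) :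
    ‖kernelE (𝕜 := ℂ) n (F' ∘ Φ) x xs‖ ≤ M * ((n : ℝ) / ρ) ^ n :=
  (norm_kernelOf_le _ xs).trans (norm_iteratedFDeriv_comp_le_of_ball hΦ hmaps hF hM hρ hρR n)

omit [NormedAddCommGroup G] [NormedSpace ℂ G] [CompleteSpace F] in
/-- **`KerZero`**: the kernels of the ZERO old term vanish (`𝐄 = 0 ∘ Φ`; the END `NE9Lemma1KernelSpecies.KerData.KerZero`).
[cite: Balaban1987RG1, (4.19)-(4.21) p.285] -/
theorem kernelE_comp_zero (Φ : (ι → 𝔸) → G) (x : ι → 𝔸) (n : ℕ) (xs : Fin n → ι) :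
    kernelE (𝕜 := ℂ) n ((0 : G → F) ∘ Φ) x xs = 0 := by
  ext b
  have h : ((0 : G → F) ∘ Φ) = (0 : (ι → 𝔸) → F) := by funext y; rfl
  rw [kernelE_apply, h, iteratedFDeriv_zero]
  rfl

/-- **The summed (4.21)∕(4.22) shape WITHOUT decay**: against fields `v₁,…,v_n : ι → 𝔸` inserted at the kernel's points,
`Σ_{xs} ‖𝐄⁽ⁿ⁾(xs)[v₁(xs₁),…,v_n(xs_n)]‖ ≤ M·(n∕ρ)ⁿ·∏_k (Σ_i ‖v_k(i)‖)` — the `ℓ¹` sizes of the fields where print has the decay-weighted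
sums `c₁(δ₁)` of (4.22). [cite: Balaban1987RG1, (4.21) p.285, (4.22) p.286] -/
theorem sum_norm_kernelE_comp_apply_le {Φ : (ι → 𝔸) → G} {F' : G → F} {x : ι → 𝔸} {Rb RX ρ M : ℝ}
    (hΦ : DifferentiableOn ℂ Φ (ball x Rb)) (hmaps : MapsTo Φ (ball x Rb) (ball 0 RX)) (hF : DifferentiableOn ℂ F' (ball 0 RX))
    (hM : ∀ y ∈ ball (0 : G) RX, ‖F' y‖ ≤ M) (hρ : 0 < ρ) (hρR : ρ < Rb) (n : ℕ) (v : Fin n → ι → 𝔸) :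
    ∑ xs : Fin n → ι, ‖kernelE (𝕜 := ℂ) n (F' ∘ Φ) x xs (fun k => v k (xs k))‖ ≤
      M * ((n : ℝ) / ρ) ^ n * ∏ k, ∑ i, ‖v k i‖ := by
  calc ∑ xs : Fin n → ι, ‖kernelE (𝕜 := ℂ) n (F' ∘ Φ) x xs (fun k => v k (xs k))‖
      ≤ ∑ xs : Fin n → ι, M * ((n : ℝ) / ρ) ^ n * ∏ k, ‖v k (xs k)‖ :=
        Finset.sum_le_sum fun xs _ => norm_kernelE_comp_apply_le hΦ hmaps hF hM hρ hρR n xs _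
    _ = M * ((n : ℝ) / ρ) ^ n * ∏ k, ∑ i, ‖v k i‖ := by
        rw [← Finset.mul_sum, Fintype.prod_sum (fun k i => ‖v k i‖)]

/-- **The printed instance `n = 4`, arguments `δB, B, B, B′`** (the second sum of (4.21) before the decay bookkeeping: `B′ = B` or the
two-point factor `(∂B)(Γ_{x,x₃})` read as a field of the last point): `Σ_{xs} ‖𝐄⁽⁴⁾(xs)[δB(xs₀), B(xs₁), B(xs₂), B′(xs₃)]‖ ≤
M·(4∕ρ)⁴·|δB|₁·|B|₁²·|B′|₁`. [cite: Balaban1987RG1, (4.21) p.285, (4.22) p.286] -/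
theorem sum_norm_kernelE_four_comp_apply_le {Φ : (ι → 𝔸) → G} {F' : G → F} {x : ι → 𝔸} {Rb RX ρ M : ℝ}
    (hΦ : DifferentiableOn ℂ Φ (ball x Rb)) (hmaps : MapsTo Φ (ball x Rb) (ball 0 RX)) (hF : DifferentiableOn ℂ F' (ball 0 RX))
    (hM : ∀ y ∈ ball (0 : G) RX, ‖F' y‖ ≤ M) (hρ : 0 < ρ) (hρR : ρ < Rb) (δB B B' : ι → 𝔸) :
    ∑ xs : Fin 4 → ι, ‖kernelE (𝕜 := ℂ) 4 (F' ∘ Φ) x xs ![δB (xs 0), B (xs 1), B (xs 2), B' (xs 3)]‖ ≤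
      M * ((4 : ℝ) / ρ) ^ 4 * ((∑ i, ‖δB i‖) * (∑ i, ‖B i‖) ^ 2 * ∑ i, ‖B' i‖) := by
  have h := sum_norm_kernelE_comp_apply_le hΦ hmaps hF hM hρ hρR 4 ![δB, B, B, B']
  have e : ∀ xs : Fin 4 → ι, (fun k => (![δB, B, B, B'] : Fin 4 → ι → 𝔸) k (xs k)) = ![δB (xs 0), B (xs 1), B (xs 2), B' (xs 3)] := by
    intro xs; funext k; fin_cases k <;> rfl
  simp_rw [e] at h
  refine h.trans (le_of_eq ?_)
  simp only [Fin.prod_univ_four, Matrix.cons_val_zero, Matrix.cons_val_one, Matrix.cons_val]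
  push_cast
  ring

end Kernel

end Literature.MathematicalPhysics.QuantumFieldTheory.Balaban1983to89.B12Eq422KernelCauchy

end
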